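import Literature.Computability.MetaComplexity.EFModAddUAssoc
import Literature.Computability.MetaComplexity.EFDerives
import HarnessLib

/-!
# Associativity of uniform modular addition in extended Frege: the size bound

The block of `ModAddU.AssocData.isBlock_lines` (`EFModAddUAssoc.lean`) has `O(L)` lines, each
of size `≤ |K| + 140`; hence its size is `O(L · (|K| + 1))` (`AssocData.proofSize_lines`). The
bookkeeping is generic: `ModAddU.Bounded B D` (every line of `D` has size `≤ B`) is closed under
the list operations used to assemble blocks, and `proofSize D ≤ |D| · B`.

## Sources

* S. A. Cook, R. A. Reckhow, *The relative efficiency of propositional proof systems*,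
  J. Symbolic Logic 44 (1979), §1–2 (length of a proof).
-/

namespace Literature.Computability.MetaComplexity

open _root_.Computability Complexity Complexity.PropForm Netlist Cluster

namespace ModAddU

/-! ### Uniformly bounded line lists -/

/-- Every line of `D` has size at most `B`. [folklore] -/
def Bounded (B : ℕ) (D : List (PropForm ℕ)) : Prop := ∀ θ ∈ D, θ.size ≤ B

namespace Bounded

variable {B B' : ℕ} {D D₁ D₂ : List (PropForm ℕ)}

/-- Monotonicity in the bound. [folklore] -/
theorem mono (h : Bounded B D) (hB : B ≤ B') : Bounded B' D := fun θ hθ => (h θ hθ).trans hB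

/-- Append. [folklore] -/
theorem append (h₁ : Bounded B D₁) (h₂ : Bounded B D₂) : Bounded B (D₁ ++ D₂) := fun θ hθ => by
  rcases List.mem_append.1 hθ with hθ | hθ
  exacts [h₁ θ hθ, h₂ θ hθ]

/-- Flatten. [folklore] -/
theorem flatten {segs : List (List (PropForm ℕ))} (h : ∀ D ∈ segs, Bounded B D) : Bounded B segs.flatten :=
  fun θ hθ => by
    obtain ⟨D, hD, hθ⟩ := List.mem_flatten.1 hθ
    exact h D hD θ hθ

/-- A map. [folklore] -/
theorem map {α : Type} {l : List α} {f : α → PropForm ℕ} (h : ∀ x ∈ l, (f x).size ≤ B) : Bounded B (l.map f) :=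
  fun θ hθ => by
    obtain ⟨x, hx, rfl⟩ := List.mem_map.1 hθ
    exact h x hx

/-- A singleton. [folklore] -/
theorem singleton {θ : PropForm ℕ} (h : θ.size ≤ B) : Bounded B [θ] := fun θ' hθ' => by
  rw [List.mem_singleton.1 hθ']; exact h

/-- **Size from a uniform bound**: `proofSize D ≤ |D| · B`. [folklore] -/
theorem proofSize_le (h : Bounded B D) : proofSize D ≤ D.length * B := by
  induction D with
  | nil => simp [proofSize]
  | cons θ D ih =>
    rw [Scaffold.proofSize_cons, List.length_cons]
    have h₁ := h θ (List.mem_cons_self ..)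
    have h₂ := ih fun θ' hθ' => h θ' (List.mem_cons_of_mem _ hθ')
    nlinarith

end Bounded

/-! ### Sizes of the recurring line shapes -/

/-- Size of a line under a context. [folklore] -/
theorem size_ctx (K L : PropForm ℕ) : (ctx K L).size = K.size + L.size + 1 := by simp only [ctx, size]

/-- Size of an invariant line. [folklore] -/
theorem size_line (S : System) (K : PropForm ℕ) (act : ℕ → ℕ → ℕ) (i : ℕ) :
    (S.line K act i).size = K.size + S.inv.size + 1 := by
  rw [System.line, size_ctx, size_inst]

/-- Lines `K ∨ (x ↔ y)`. [folklore] -/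
theorem bounded_ctx_eqv {B : ℕ} (K : PropForm ℕ) (hK : K.size + 10 ≤ B) {α : Type} (l : List α) (f g : α → ℕ) :
    Bounded B (l.map fun x => ctx K (eqv (f x) (g x))) :=
  Bounded.map fun x _ => by rw [size_ctx, FregeSystem.size_eqv]; omega

/-- Invariant lines. [folklore] -/
theorem bounded_sysLines {B : ℕ} (S : System) (K : PropForm ℕ) (act : ℕ → ℕ → ℕ) (W : ℕ)
    (h : K.size + S.inv.size + 1 ≤ B) : Bounded B (S.lines K act W) :=
  Bounded.map fun i _ => by rw [size_line]; exact h

/-- Induction with per-position conclusions `x ↔ y`. [folklore] -/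
theorem bounded_posBlock {B : ℕ} (S : System) (K : PropForm ℕ) (act : ℕ → ℕ → ℕ) (W a b : ℕ)
    (h : K.size + S.inv.size + 1 ≤ B) (h10 : 10 ≤ S.inv.size) : Bounded B (posBlock S K act W (biimp (var a) (var b))) :=
  (bounded_sysLines S K act W h).append (Bounded.map fun i _ => by
    rw [size_ctx, size_inst, FregeSystem.size_biimp]; simp [size]; omega)

/-- Congruence lines of subtractors. [folklore] -/
theorem bounded_subLeib {B : ℕ} (S T : Sub.View) (K : PropForm ℕ) (w : ℕ) (hK : K.size + 10 ≤ B) :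
    Bounded B (Sub.leibLines S T K w) :=
  (bounded_ctx_eqv K hK _ _ _).append (bounded_ctx_eqv K hK _ _ _)

/-- Reflexivity lines. [folklore] -/
theorem bounded_refl {B : ℕ} (K : PropForm ℕ) (vs : List ℕ) (hK : K.size + 10 ≤ B) : Bounded B (Adder.reflLines K vs) :=
  bounded_ctx_eqv K hK _ _ _

/-- Weakened lines. [folklore] -/
theorem bounded_weak {B C : ℕ} (K A : PropForm ℕ) {Ls : List (PropForm ℕ)} (h : ∀ L ∈ Ls, L.size ≤ C)
    (hB : K.size + A.size + C + 2 ≤ B) : Bounded B (Logic.weakLines K A Ls) :=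
  Bounded.map fun L hL => by rw [size_ctx]; simp only [size]; have := h L hL; omega

/-- The invariant sizes. [folklore] -/
theorem size_invs : SAC.inv.size = 85 ∧ SACL.inv.size = 85 ∧ AU.inv.size = 59 ∧ B4.inv.size = 72 ∧
    NG2.inv.size = 133 ∧ NG2L.inv.size = 133 ∧ G1.inv.size = 14 ∧ G1L.inv.size = 14 := by
  refine ⟨?_, ?_, ?_, ?_, ?_, ?_, ?_, ?_⟩ <;> decide +kernel

/-- Size of the counting formula. [folklore] -/
theorem size_invF (a b c e : ℕ) : (Adder.invF (var a) (var b) (var c) (var e)).size = 59 := by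
  simp only [Adder.invF, FregeSystem.size_biimp, size]

namespace AssocData

/-- The items of the weakening lists are small. [folklore] -/
theorem size_le_of_mem_subDefList {V : Sub.View} {w : ℕ} {θ : PropForm ℕ} (h : θ ∈ subDefList V w) : θ.size ≤ 57 := by
  simp only [subDefList, List.mem_append, List.mem_map, List.mem_range, List.mem_singleton] at h
  rcases h with ⟨j, -, rfl⟩ | rfl | ⟨i, -, rfl⟩ | ⟨i, -, rfl⟩
  · rw [(size_defs (V.adder w) V j true).2.2.2]; omega
  · rw [(size_defs (V.adder w) V 0 true).2.2.1]; omega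
  · rw [(size_defs (V.adder w) V i true).1]
  · rw [(size_defs (V.adder w) V i true).2.1]; omega

/-- The items of the weakening lists are small. [folklore] -/
theorem size_le_of_mem_muxDefList {g : ℕ → ℕ} {sel : ℕ} {x y : ℕ → ℕ} {W : ℕ} {θ : PropForm ℕ}
    (h : θ ∈ muxDefList g sel x y W) : θ.size ≤ 57 := by
  obtain ⟨i, -, rfl⟩ := List.mem_map.1 h
  rw [muxLine, FregeSystem.size_biimp]; simp [size, muxF]

variable (d : AssocData) (K : PropForm ℕ)

/-- The lines weakened into the branches are small. [folklore] -/
theorem size_le_of_mem_wk :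
    (∀ θ ∈ d.wkT, θ.size ≤ 133) ∧ (∀ θ ∈ d.wkF, θ.size ≤ 133) ∧ (∀ θ ∈ d.wkT', θ.size ≤ 133) ∧ (∀ θ ∈ d.wkF', θ.size ≤ 133) := by
  obtain ⟨-, -, -, -, h5, h6, h7, h8⟩ := size_invs
  refine ⟨fun θ hθ => ?_, fun θ hθ => ?_, fun θ hθ => ?_, fun θ hθ => ?_⟩
  · simp only [wkT, List.mem_append, List.mem_cons, List.not_mem_nil, or_false] at hθ
    rcases hθ with (rfl | rfl | rfl) | hθ | hθ | hθ | hθ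
    · rw [size_inst]; omega
    · simp [size]
    · rw [FregeSystem.size_eqv]; omega
    · exact (size_le_of_mem_muxDefList hθ).trans (by omega)
    · exact (size_le_of_mem_muxDefList hθ).trans (by omega)
    · exact (size_le_of_mem_subDefList hθ).trans (by omega)
    · exact (size_le_of_mem_subDefList hθ).trans (by omega)
  · simp only [wkF, List.mem_append, List.mem_cons, List.not_mem_nil, or_false] at hθ
    rcases hθ with (rfl | rfl | rfl) | hθ | hθ | hθ
    · rw [size_inst]; omega
    · simp [size]
    · rw [FregeSystem.size_eqv]; omega
    · exact (size_le_of_mem_muxDefList hθ).trans (by omega)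
    · exact (size_le_of_mem_subDefList hθ).trans (by omega)
    · exact (size_le_of_mem_subDefList hθ).trans (by omega)
  · simp only [wkT', List.mem_append, List.mem_cons, List.not_mem_nil, or_false] at hθ
    rcases hθ with (rfl | rfl | rfl) | hθ | hθ | hθ | hθ
    · rw [size_inst]; omega
    · simp [size]
    · rw [FregeSystem.size_eqv]; omega
    · exact (size_le_of_mem_muxDefList hθ).trans (by omega)
    · exact (size_le_of_mem_muxDefList hθ).trans (by omega)
    · exact (size_le_of_mem_subDefList hθ).trans (by omega)
    · exact (size_le_of_mem_subDefList hθ).trans (by omega)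
  · simp only [wkF', List.mem_append, List.mem_cons, List.not_mem_nil, or_false] at hθ
    rcases hθ with (rfl | rfl | rfl) | hθ | hθ | hθ
    · rw [size_inst]; omega
    · simp [size]
    · rw [FregeSystem.size_eqv]; omega
    · exact (size_le_of_mem_muxDefList hθ).trans (by omega)
    · exact (size_le_of_mem_subDefList hθ).trans (by omega)
    · exact (size_le_of_mem_subDefList hθ).trans (by omega)

/-- Every line of count T has size `≤ |K| + 140`. [folklore] -/
theorem bounded_countT : Bounded (K.size + 140) (d.countT K) := by
  obtain ⟨-, -, -, -, -, -, h7, -⟩ := size_invs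
  obtain ⟨w₁, w₂, -, -⟩ := d.size_le_of_mem_wk
  have hT : (d.KT K).size = K.size + 3 := by simp [KT, size]
  have hF : (d.KF K).size = K.size + 2 := by simp [KF, size]
  refine ((Bounded.flatten fun D hD => ?_).append (Bounded.flatten fun D hD => ?_)).append
    (Bounded.map fun L hL => ?_)
  · simp only [segsT, List.mem_cons, List.not_mem_nil, or_false] at hD
    rcases hD with rfl | rfl | rfl | rfl | rfl | rfl | rfl | rfl | rfl | rfl
    · exact Bounded.singleton (by rw [size_ctx, hT]; simp [size])
    · exact bounded_weak K _ w₁ (by simp [size])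
    · exact bounded_ctx_eqv _ (by omega) _ _ _
    · exact Bounded.singleton (by rw [size_ctx, hT]; simp [size])
    · exact bounded_ctx_eqv _ (by omega) _ _ _
    · exact bounded_ctx_eqv _ (by omega) _ _ _
    · exact bounded_refl _ _ (by omega)
    · exact bounded_subLeib _ _ _ _ (by omega)
    · exact Bounded.singleton (by rw [size_ctx, hT, FregeSystem.size_eqv]; omega)
    · exact Bounded.singleton (by rw [size_ctx, hT, size_invF]; omega)
  · simp only [segsF, List.mem_cons, List.not_mem_nil, or_false] at hD
    rcases hD with rfl | rfl | rfl | rfl | rfl | rfl | rfl | rfl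
    · exact Bounded.singleton (by rw [size_ctx, hF]; simp [size])
    · exact bounded_weak K _ w₂ (by simp [size])
    · exact bounded_ctx_eqv _ (by omega) _ _ _
    · exact bounded_refl _ _ (by omega)
    · exact bounded_subLeib _ _ _ _ (by omega)
    · exact Bounded.singleton (by rw [size_ctx, hF, FregeSystem.size_eqv]; omega)
    · exact Bounded.singleton (by rw [size_ctx, hF]; simp [size])
    · exact Bounded.singleton (by rw [size_ctx, hF, size_invF]; omega)
  · rw [List.mem_singleton.1 hL, size_ctx, size_invF]; omega

/-- Every line of count V has size `≤ |K| + 140`. [folklore] -/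
theorem bounded_countV : Bounded (K.size + 140) (d.countV K) := by
  obtain ⟨-, -, -, -, -, -, -, h8⟩ := size_invs
  obtain ⟨-, -, w₁, w₂⟩ := d.size_le_of_mem_wk
  have hT : (d.KT' K).size = K.size + 3 := by simp [KT', size]
  have hF : (d.KF' K).size = K.size + 2 := by simp [KF', size]
  refine ((Bounded.flatten fun D hD => ?_).append (Bounded.flatten fun D hD => ?_)).append
    (Bounded.map fun L hL => ?_)
  · simp only [segsT', List.mem_cons, List.not_mem_nil, or_false] at hD
    rcases hD with rfl | rfl | rfl | rfl | rfl | rfl | rfl | rfl | rfl | rfl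
    · exact Bounded.singleton (by rw [size_ctx, hT]; simp [size])
    · exact bounded_weak K _ w₁ (by simp [size])
    · exact bounded_ctx_eqv _ (by omega) _ _ _
    · exact Bounded.singleton (by rw [size_ctx, hT]; simp [size])
    · exact bounded_ctx_eqv _ (by omega) _ _ _
    · exact bounded_ctx_eqv _ (by omega) _ _ _
    · exact bounded_refl _ _ (by omega)
    · exact bounded_subLeib _ _ _ _ (by omega)
    · exact Bounded.singleton (by rw [size_ctx, hT, FregeSystem.size_eqv]; omega)
    · exact Bounded.singleton (by rw [size_ctx, hT, size_invF]; omega)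
  · simp only [segsF', List.mem_cons, List.not_mem_nil, or_false] at hD
    rcases hD with rfl | rfl | rfl | rfl | rfl | rfl | rfl | rfl
    · exact Bounded.singleton (by rw [size_ctx, hF]; simp [size])
    · exact bounded_weak K _ w₂ (by simp [size])
    · exact bounded_ctx_eqv _ (by omega) _ _ _
    · exact bounded_refl _ _ (by omega)
    · exact bounded_subLeib _ _ _ _ (by omega)
    · exact Bounded.singleton (by rw [size_ctx, hF, FregeSystem.size_eqv]; omega)
    · exact Bounded.singleton (by rw [size_ctx, hF]; simp [size])
    · exact Bounded.singleton (by rw [size_ctx, hF, size_invF]; omega)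
  · rw [List.mem_singleton.1 hL, size_ctx, size_invF]; omega

/-- **Every line of the associativity law has size `≤ |K| + 140`.** [folklore] -/
theorem bounded_lines : Bounded (K.size + 140) (d.lines K) := by
  obtain ⟨h1, h2, h3, h4, h5, h6, h7, h8⟩ := size_invs
  refine Bounded.flatten fun D hD => ?_
  simp only [segs, List.mem_cons, List.not_mem_nil, or_false] at hD
  rcases hD with rfl | rfl | rfl | rfl | rfl | rfl | rfl | rfl | rfl | rfl | rfl | rfl | rfl | rfl | rfl | rfl | rfl
  · exact bounded_refl _ _ (by omega)
  · exact bounded_posBlock _ _ _ _ _ _ (by omega) (by omega)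
  · exact bounded_posBlock _ _ _ _ _ _ (by omega) (by omega)
  · exact bounded_posBlock _ _ _ _ _ _ (by omega) (by omega)
  · exact (bounded_subLeib _ _ _ _ (by omega)).append (bounded_ctx_eqv _ (by omega) _ _ _)
  · exact (bounded_subLeib _ _ _ _ (by omega)).append ((bounded_ctx_eqv _ (by omega) _ _ _).append
      ((bounded_ctx_eqv _ (by omega) _ _ _).append ((bounded_subLeib _ _ _ _ (by omega)).append
        (bounded_ctx_eqv _ (by omega) _ _ _))))
  · exact bounded_sysLines _ _ _ _ (by omega)
  · exact bounded_sysLines _ _ _ _ (by omega)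
  · exact bounded_sysLines _ _ _ _ (by omega)
  · exact bounded_sysLines _ _ _ _ (by omega)
  · intro θ hθ
    simp only [bookLines, List.mem_cons, List.not_mem_nil, or_false] at hθ
    rcases hθ with rfl | rfl | rfl | rfl | rfl | rfl <;> (rw [size_ctx]; simp [size])
  · exact d.bounded_countT K
  · exact d.bounded_countV K
  · exact Bounded.singleton (by rw [size_ctx, validLine, size_invF]; omega)
  · exact bounded_posBlock _ _ _ _ _ _ (by omega) (by omega)
  · exact bounded_ctx_eqv _ (by omega) _ _ _
  · exact bounded_ctx_eqv _ (by omega) _ _ _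

/-- **The associativity law has `82L + 65` lines.** [folklore] -/
theorem length_lines : (d.lines K).length = 82 * d.L + 65 := by
  simp only [lines, segs, countT, countV, segsT, segsF, segsT', segsF', wkT, wkF, wkT', wkF', sb1, sb2, sb3, sb4,
    posBlock, chainT, chainV, bookLines, subDefList, muxDefList, muxLeibLines, System.lines, Sub.leibLines,
    Adder.leibLines, Adder.reflLines, Logic.weakLines, Logic.mergeLines, List.flatten_cons, List.flatten_nil,
    List.length_append, List.length_map, List.length_range, List.length_cons, List.length_nil, List.append_nil]
  ring

/-- **Size of the associativity law**: at most `(82L + 65)(|K| + 140)` symbols.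
[cite: CookReckhow1979, §1–2 (length of a proof)] -/
theorem proofSize_lines : proofSize (d.lines K) ≤ (82 * d.L + 65) * (K.size + 140) := by
  rw [← d.length_lines K]
  exact (d.bounded_lines K).proofSize_le

end AssocData

end ModAddU

end Literature.Computability.MetaComplexity
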